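import Mathlib
import Summits.Ventures.PercRepro2.Independence
import Summits.Ventures.PercRepro2.Harris
import Summits.Ventures.PercRepro2.HCov
import Summits.Ventures.PercRepro2.CutVertexPaths
import Summits.Ventures.PercRepro2.CutOneFarConn
import Summits.Ventures.PercRepro2.CutTwoFarConn
import Summits.Ventures.PercRepro2.CutTwoFarLaw

/-!
# Two marks behind a cut vertex, III: `Gc` IS A CUBIC IN THE LAW OF THE PART (blind cell
PercRepro2, typer-1 g50)

S3 §12.1 ((G5) of proofs/subclaims/S3-CLASSES.md) in the kernel.  With `v` a cut vertex, the marks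
`w₁, w₂` on the left and the other marks in `Rt ∪ {v}` (`MarksOK`), every one of the twelve basic
masses of the covariance form — `P(Q)`, `D`, `D_o`, `E_Q[σ_b σ_o]`, `E_Q[σ_b σ₃]`,
`E_Q[σ_b σ₃ 1_{o∈U}]`, `gap`, `E_Q[σ_o]`, `E_Q[σ₃]`, `E_Q[σ₃ 1_{o∈U}]`, `P(PD, b∈U)`,
`P(PD, b∈U, o∈U)` — is the `patProb`-mixture of the same mass on the gadget graphs
(`PQ_mix`, `D_mix`, `Do_mix`, `EQbo_mix`, `EQb3_mix`, `EQb3o_mix`, `gap_mix`, `EQo_mix`,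
`EQ3_mix`, `EQ3o_mix`, `PDb_mix`, `PDbo_mix`; the mark events are pattern events, transported by
`conn_marks_iff`, and `prob_Ψ_preimage` is the mixture law), hence

  **`Gc_eq_mix`**: `Gc(A ∪_v B) = Gc_poly(∑_τ patProb(τ) · X^τ(B))` — the cubic polynomial of `Gc`
  at the mixed masses, i.e. «the pattern law of `{v} ∪ M_A` inside `A` is all `Gc` sees»,

and **`Gc_eq_of_patProb_eq`**: two weight vectors with the same right weights and the same law of
the part have the same covariance form.  (With `w₁ = w₂`, or one of them equal to `v`, this
contains the one-far-mark equivalence `CutOneFar.Gc_eq_reduced` as the two-valued case.)  Own work;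
standard axioms.
-/

namespace Summit.Ventures.PercRepro2

open CovForm CutVertexM9

namespace CutTwoFar

/-! ## The basic masses of the covariance form are mixtures; `Gc` is a cubic in the law of the
part -/

section Masses

variable {V : Type*} {E : Type*} [Fintype E] [DecidableEq E] {R : Type*} [Field R]
variable {ends : E → Sym2 V} {side : E → Bool} {L : Set V} {v : V} {Rt : Set V} {w₁ w₂ : V}

/-- The five-mark hypothesis: every mark is `w₁`, `w₂`, or lies in `Rt ∪ {v}`. -/
def MarksOK (w₁ w₂ : V) (Rt : Set V) (v : V) (o a₁ a₂ a₃ b : V) : Prop :=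
  ∀ m ∈ ({o, a₁, a₂, a₃, b} : Set V), m = w₁ ∨ m = w₂ ∨ m ∈ Rt ∨ m = v

omit [Fintype E] [DecidableEq E] in
/-- Connectivity between the five marks is transported by `Ψ`. -/
lemma conn_marks_iff_of_marksOK (h : CutVertex ends side L v Rt) (hw₁ : w₁ ∈ L ∨ w₁ = v)
    (hw₂ : w₂ ∈ L ∨ w₂ = v) {o a₁ a₂ a₃ b : V} (hM : MarksOK w₁ w₂ Rt v o a₁ a₂ a₃ b) :
    ∀ ω, ∀ x ∈ ({o, a₁, a₂, a₃, b} : Set V), ∀ z ∈ ({o, a₁, a₂, a₃, b} : Set V),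
      Conn (gends ends side v w₁ w₂) (Ψ ends side v w₁ w₂ ω) x z ↔ Conn ends ω x z :=
  fun ω x hx z hz => conn_marks_iff h hw₁ hw₂ ω (hM x hx) (hM z hz)

/-- The mark-membership facts, bundled. -/
lemma marks_mem (o a₁ a₂ a₃ b : V) :
    o ∈ ({o, a₁, a₂, a₃, b} : Set V) ∧ a₁ ∈ ({o, a₁, a₂, a₃, b} : Set V) ∧
      a₂ ∈ ({o, a₁, a₂, a₃, b} : Set V) ∧ a₃ ∈ ({o, a₁, a₂, a₃, b} : Set V) ∧
      b ∈ ({o, a₁, a₂, a₃, b} : Set V) := by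
  simp

variable (h : CutVertex ends side L v Rt) (hw₁ : w₁ ∈ L ∨ w₁ = v) (hw₂ : w₂ ∈ L ∨ w₂ = v)
  (p : E → R) {o a₁ a₂ a₃ b : V} (hM : MarksOK w₁ w₂ Rt v o a₁ a₂ a₃ b)

include h hw₁ hw₂ hM

/-- `P(Q)` is a mixture. -/
theorem PQ_mix : prob p (avoidAll ends a₂ {a₁}) =
    ∑ τ, patProb ends side v w₁ w₂ p τ *
      prob (gweights side p τ) (avoidAll (gends ends side v w₁ w₂) a₂ {a₁}) := by
  obtain ⟨ho, h1, h2, h3, hb⟩ := marks_mem o a₁ a₂ a₃ b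
  have hH := conn_marks_iff_of_marksOK h hw₁ hw₂ hM
  rw [← prob_Ψ_preimage, CutOneFar.preimage_avoidAll_singleton_of_mem' hH h2 h1]

/-- `D = P(PD)` is a mixture. -/
theorem D_mix : prob p (PDEvent ends a₁ a₂ a₃) =
    ∑ τ, patProb ends side v w₁ w₂ p τ *
      prob (gweights side p τ) (PDEvent (gends ends side v w₁ w₂) a₁ a₂ a₃) := by
  obtain ⟨ho, h1, h2, h3, hb⟩ := marks_mem o a₁ a₂ a₃ b
  have hH := conn_marks_iff_of_marksOK h hw₁ hw₂ hM
  rw [← prob_Ψ_preimage, CutOneFar.preimage_PDEvent_of_mem' hH h1 h2 h3]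

/-- `D_o` is a mixture. -/
theorem Do_mix : Do p ends o a₁ a₂ a₃ =
    ∑ τ, patProb ends side v w₁ w₂ p τ * Do (gweights side p τ) (gends ends side v w₁ w₂) o a₁ a₂ a₃ := by
  obtain ⟨ho, h1, h2, h3, hb⟩ := marks_mem o a₁ a₂ a₃ b
  have hH := conn_marks_iff_of_marksOK h hw₁ hw₂ hM
  simp only [Do, mul_add, Finset.sum_add_distrib, ← prob_Ψ_preimage, Set.preimage_inter,
    CutOneFar.preimage_PDEvent_of_mem' hH h1 h2 h3, CutOneFar.preimage_connEvent_of_mem' hH h1 ho,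
    CutOneFar.preimage_connEvent_of_mem' hH h2 ho]

/-- `E_Q[σ_b σ_o]` is a mixture. -/
theorem EQbo_mix : EQbo p ends o a₁ a₂ b =
    ∑ τ, patProb ends side v w₁ w₂ p τ * EQbo (gweights side p τ) (gends ends side v w₁ w₂) o a₁ a₂ b := by
  obtain ⟨ho, h1, h2, h3, hb⟩ := marks_mem o a₁ a₂ a₃ b
  have hH := conn_marks_iff_of_marksOK h hw₁ hw₂ hM
  simp only [EQbo, mul_add, mul_sub, Finset.sum_add_distrib, Finset.sum_sub_distrib,
    ← prob_Ψ_preimage, Set.preimage_inter, CutOneFar.preimage_avoidAll_singleton_of_mem' hH h2 h1,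
    CutOneFar.preimage_connEvent_of_mem' hH h1 ho, CutOneFar.preimage_connEvent_of_mem' hH h2 ho,
    CutOneFar.preimage_connEvent_of_mem' hH h1 hb, CutOneFar.preimage_connEvent_of_mem' hH h2 hb]

/-- `E_Q[σ_b σ₃]` is a mixture. -/
theorem EQb3_mix : EQb3 p ends a₁ a₂ a₃ b =
    ∑ τ, patProb ends side v w₁ w₂ p τ * EQb3 (gweights side p τ) (gends ends side v w₁ w₂) a₁ a₂ a₃ b := by
  obtain ⟨ho, h1, h2, h3, hb⟩ := marks_mem o a₁ a₂ a₃ b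
  have hH := conn_marks_iff_of_marksOK h hw₁ hw₂ hM
  simp only [EQb3, mul_add, mul_sub, Finset.sum_add_distrib, Finset.sum_sub_distrib,
    ← prob_Ψ_preimage, Set.preimage_inter, CutOneFar.preimage_TEvent_of_mem' hH h1 h2 h3,
    CutOneFar.preimage_TEvent_of_mem' hH h2 h1 h3, CutOneFar.preimage_connEvent_of_mem' hH h1 hb,
    CutOneFar.preimage_connEvent_of_mem' hH h2 hb]

/-- `E_Q[σ_b σ₃ 1_{o ∈ U}]` is a mixture. -/
theorem EQb3o_mix : EQb3o p ends o a₁ a₂ a₃ b =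
    ∑ τ, patProb ends side v w₁ w₂ p τ *
      EQb3o (gweights side p τ) (gends ends side v w₁ w₂) o a₁ a₂ a₃ b := by
  obtain ⟨ho, h1, h2, h3, hb⟩ := marks_mem o a₁ a₂ a₃ b
  have hH := conn_marks_iff_of_marksOK h hw₁ hw₂ hM
  simp only [EQb3o, mul_add, mul_sub, Finset.sum_add_distrib, Finset.sum_sub_distrib,
    ← prob_Ψ_preimage, Set.preimage_inter, CutOneFar.preimage_TEvent_of_mem' hH h1 h2 h3,
    CutOneFar.preimage_TEvent_of_mem' hH h2 h1 h3, CutOneFar.preimage_connEvent_of_mem' hH h1 ho,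
    CutOneFar.preimage_connEvent_of_mem' hH h2 ho, CutOneFar.preimage_connEvent_of_mem' hH h1 hb,
    CutOneFar.preimage_connEvent_of_mem' hH h2 hb]

/-- The labelling gap is a mixture. -/
theorem gap_mix : gap p ends a₁ a₂ b =
    ∑ τ, patProb ends side v w₁ w₂ p τ * gap (gweights side p τ) (gends ends side v w₁ w₂) a₁ a₂ b := by
  obtain ⟨ho, h1, h2, h3, hb⟩ := marks_mem o a₁ a₂ a₃ b
  have hH := conn_marks_iff_of_marksOK h hw₁ hw₂ hM
  simp only [gap, mul_sub, Finset.sum_sub_distrib, ← prob_Ψ_preimage,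
    CutOneFar.preimage_connEvent_of_mem' hH h1 hb, CutOneFar.preimage_connEvent_of_mem' hH h2 hb]

/-- `E_Q[σ_o]` is a mixture. -/
theorem EQo_mix : EQo p ends o a₁ a₂ =
    ∑ τ, patProb ends side v w₁ w₂ p τ * EQo (gweights side p τ) (gends ends side v w₁ w₂) o a₁ a₂ := by
  obtain ⟨ho, h1, h2, h3, hb⟩ := marks_mem o a₁ a₂ a₃ b
  have hH := conn_marks_iff_of_marksOK h hw₁ hw₂ hM
  simp only [EQo, mul_sub, Finset.sum_sub_distrib, ← prob_Ψ_preimage, Set.preimage_inter,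
    CutOneFar.preimage_avoidAll_singleton_of_mem' hH h2 h1,
    CutOneFar.preimage_connEvent_of_mem' hH h1 ho, CutOneFar.preimage_connEvent_of_mem' hH h2 ho]

/-- `E_Q[σ₃]` is a mixture. -/
theorem EQ3_mix : EQ3 p ends a₁ a₂ a₃ =
    ∑ τ, patProb ends side v w₁ w₂ p τ * EQ3 (gweights side p τ) (gends ends side v w₁ w₂) a₁ a₂ a₃ := by
  obtain ⟨ho, h1, h2, h3, hb⟩ := marks_mem o a₁ a₂ a₃ b
  have hH := conn_marks_iff_of_marksOK h hw₁ hw₂ hM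
  simp only [EQ3, mul_sub, Finset.sum_sub_distrib, ← prob_Ψ_preimage,
    CutOneFar.preimage_TEvent_of_mem' hH h1 h2 h3, CutOneFar.preimage_TEvent_of_mem' hH h2 h1 h3]

/-- `E_Q[σ₃ 1_{o ∈ U}]` is a mixture. -/
theorem EQ3o_mix : EQ3o p ends o a₁ a₂ a₃ =
    ∑ τ, patProb ends side v w₁ w₂ p τ * EQ3o (gweights side p τ) (gends ends side v w₁ w₂) o a₁ a₂ a₃ := by
  obtain ⟨ho, h1, h2, h3, hb⟩ := marks_mem o a₁ a₂ a₃ b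
  have hH := conn_marks_iff_of_marksOK h hw₁ hw₂ hM
  simp only [EQ3o, mul_add, mul_sub, Finset.sum_add_distrib, Finset.sum_sub_distrib,
    ← prob_Ψ_preimage, Set.preimage_inter, CutOneFar.preimage_TEvent_of_mem' hH h1 h2 h3,
    CutOneFar.preimage_TEvent_of_mem' hH h2 h1 h3, CutOneFar.preimage_connEvent_of_mem' hH h1 ho,
    CutOneFar.preimage_connEvent_of_mem' hH h2 ho]

/-- `P(PD, b ∈ U)` is a mixture. -/
theorem PDb_mix : PDb p ends a₁ a₂ a₃ b =
    ∑ τ, patProb ends side v w₁ w₂ p τ * PDb (gweights side p τ) (gends ends side v w₁ w₂) a₁ a₂ a₃ b := by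
  obtain ⟨ho, h1, h2, h3, hb⟩ := marks_mem o a₁ a₂ a₃ b
  have hH := conn_marks_iff_of_marksOK h hw₁ hw₂ hM
  simp only [PDb, mul_add, Finset.sum_add_distrib, ← prob_Ψ_preimage, Set.preimage_inter,
    CutOneFar.preimage_PDEvent_of_mem' hH h1 h2 h3, CutOneFar.preimage_connEvent_of_mem' hH h1 hb,
    CutOneFar.preimage_connEvent_of_mem' hH h2 hb]

/-- `P(PD, b ∈ U, o ∈ U)` is a mixture. -/
theorem PDbo_mix : PDbo p ends o a₁ a₂ a₃ b =
    ∑ τ, patProb ends side v w₁ w₂ p τ * PDbo (gweights side p τ) (gends ends side v w₁ w₂) o a₁ a₂ a₃ b := by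
  obtain ⟨ho, h1, h2, h3, hb⟩ := marks_mem o a₁ a₂ a₃ b
  have hH := conn_marks_iff_of_marksOK h hw₁ hw₂ hM
  simp only [PDbo, mul_add, Finset.sum_add_distrib, ← prob_Ψ_preimage, Set.preimage_inter,
    CutOneFar.preimage_PDEvent_of_mem' hH h1 h2 h3, CutOneFar.preimage_connEvent_of_mem' hH h1 ho,
    CutOneFar.preimage_connEvent_of_mem' hH h2 ho, CutOneFar.preimage_connEvent_of_mem' hH h1 hb,
    CutOneFar.preimage_connEvent_of_mem' hH h2 hb]

/-- **THE LAW OF THE PART** (S3 §12.1): the covariance form of `G = A ∪_v B` with the two marks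
`w₁, w₂` in `A` is the cubic polynomial of `Gc` evaluated at the `patProb`-mixtures of the twelve
basic masses of the gadget graphs — `Gc` depends on the part `A` only through the law of its
connection pattern on `{v, w₁, w₂}`. -/
theorem Gc_eq_mix : Gc p ends o a₁ a₂ a₃ b =
    (∑ τ, patProb ends side v w₁ w₂ p τ *
        prob (gweights side p τ) (avoidAll (gends ends side v w₁ w₂) a₂ {a₁})) *
      ((∑ τ, patProb ends side v w₁ w₂ p τ *
          prob (gweights side p τ) (PDEvent (gends ends side v w₁ w₂) a₁ a₂ a₃)) *
        (∑ τ, patProb ends side v w₁ w₂ p τ *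
          EQbo (gweights side p τ) (gends ends side v w₁ w₂) o a₁ a₂ b) +
        (∑ τ, patProb ends side v w₁ w₂ p τ *
          Do (gweights side p τ) (gends ends side v w₁ w₂) o a₁ a₂ a₃) *
        (∑ τ, patProb ends side v w₁ w₂ p τ *
          EQb3 (gweights side p τ) (gends ends side v w₁ w₂) a₁ a₂ a₃ b) -
        (∑ τ, patProb ends side v w₁ w₂ p τ *
          prob (gweights side p τ) (PDEvent (gends ends side v w₁ w₂) a₁ a₂ a₃)) *
        (∑ τ, patProb ends side v w₁ w₂ p τ *
          EQb3o (gweights side p τ) (gends ends side v w₁ w₂) o a₁ a₂ a₃ b)) +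
    (∑ τ, patProb ends side v w₁ w₂ p τ *
        gap (gweights side p τ) (gends ends side v w₁ w₂) a₁ a₂ b) *
      ((∑ τ, patProb ends side v w₁ w₂ p τ *
          prob (gweights side p τ) (PDEvent (gends ends side v w₁ w₂) a₁ a₂ a₃)) *
        (∑ τ, patProb ends side v w₁ w₂ p τ *
          EQo (gweights side p τ) (gends ends side v w₁ w₂) o a₁ a₂) +
        (∑ τ, patProb ends side v w₁ w₂ p τ *
          Do (gweights side p τ) (gends ends side v w₁ w₂) o a₁ a₂ a₃) *
        (∑ τ, patProb ends side v w₁ w₂ p τ *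
          EQ3 (gweights side p τ) (gends ends side v w₁ w₂) a₁ a₂ a₃) -
        (∑ τ, patProb ends side v w₁ w₂ p τ *
          prob (gweights side p τ) (PDEvent (gends ends side v w₁ w₂) a₁ a₂ a₃)) *
        (∑ τ, patProb ends side v w₁ w₂ p τ *
          EQ3o (gweights side p τ) (gends ends side v w₁ w₂) o a₁ a₂ a₃)) +
    (∑ τ, patProb ends side v w₁ w₂ p τ *
        prob (gweights side p τ) (avoidAll (gends ends side v w₁ w₂) a₂ {a₁})) *
      ((∑ τ, patProb ends side v w₁ w₂ p τ *
          Do (gweights side p τ) (gends ends side v w₁ w₂) o a₁ a₂ a₃) *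
        (∑ τ, patProb ends side v w₁ w₂ p τ *
          PDb (gweights side p τ) (gends ends side v w₁ w₂) a₁ a₂ a₃ b) -
        (∑ τ, patProb ends side v w₁ w₂ p τ *
          prob (gweights side p τ) (PDEvent (gends ends side v w₁ w₂) a₁ a₂ a₃)) *
        (∑ τ, patProb ends side v w₁ w₂ p τ *
          PDbo (gweights side p τ) (gends ends side v w₁ w₂) o a₁ a₂ a₃ b)) := by
  rw [Gc, DEF, PQ_mix h hw₁ hw₂ p hM, D_mix h hw₁ hw₂ p hM, Do_mix h hw₁ hw₂ p hM,
    EQbo_mix h hw₁ hw₂ p hM, EQb3_mix h hw₁ hw₂ p hM, EQb3o_mix h hw₁ hw₂ p hM,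
    gap_mix h hw₁ hw₂ p hM, EQo_mix h hw₁ hw₂ p hM, EQ3_mix h hw₁ hw₂ p hM,
    EQ3o_mix h hw₁ hw₂ p hM, PDb_mix h hw₁ hw₂ p hM, PDbo_mix h hw₁ hw₂ p hM]

omit hM in
/-- **Transport across the part**: two weight vectors with the same right weights and the same law
of the part have the same covariance form. -/
theorem Gc_eq_of_patProb_eq {p' : E → R} (hR : ∀ e, side e = false → p e = p' e)
    (hpat : ∀ τ, patProb ends side v w₁ w₂ p τ = patProb ends side v w₁ w₂ p' τ)
    (o a₁ a₂ a₃ b : V) (hM : MarksOK w₁ w₂ Rt v o a₁ a₂ a₃ b) :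
    Gc p ends o a₁ a₂ a₃ b = Gc p' ends o a₁ a₂ a₃ b := by
  rw [Gc_eq_mix h hw₁ hw₂ p hM, Gc_eq_mix h hw₁ hw₂ p' hM]
  simp only [hpat, gweights_eq_of_agree side hR]

end Masses

/-! ## The five-state law -/

section FiveStates

variable {V : Type*} {E : Type*} [Fintype E] [DecidableEq E] {R : Type*} [Field R]

/-- The five transitive patterns of `{v, w₁, w₂}`: all apart, all joined, `w₁ ↔ v` only,
`w₂ ↔ v` only, `w₁ ↔ w₂` only. -/
def transPatterns : Finset (Fin 3 → Bool) :=
  {![false, false, false], ![true, true, true], ![true, false, false], ![false, true, false],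
    ![false, false, true]}

/-- A pattern outside the five transitive ones has two pairs joined and the third not. -/
lemma nontransitive_of_not_mem {τ : Fin 3 → Bool} (hτ : τ ∉ transPatterns) :
    (τ 0 = true ∧ τ 1 = true ∧ τ 2 = false) ∨ (τ 0 = true ∧ τ 2 = true ∧ τ 1 = false) ∨
      (τ 1 = true ∧ τ 2 = true ∧ τ 0 = false) := by
  revert τ
  decide

/-- **The five-state law**: every `patProb`-mixture is a sum over the five transitive patterns. -/
theorem mix_eq_sum_transPatterns (ends : E → Sym2 V) (side : E → Bool) (v w₁ w₂ : V) (p : E → R)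
    (X : (Fin 3 → Bool) → R) :
    ∑ τ, patProb ends side v w₁ w₂ p τ * X τ =
      ∑ τ ∈ transPatterns, patProb ends side v w₁ w₂ p τ * X τ := by
  symm
  refine Finset.sum_subset (Finset.subset_univ _) fun τ _ hτ => ?_
  rw [patProb_eq_zero_of_nontransitive ends side v w₁ w₂ p (nontransitive_of_not_mem hτ), zero_mul]

end FiveStates

end CutTwoFar

end Summit.Ventures.PercRepro2
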